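import Summits.NavierStokesRegularity.NavierStokesRegularity.Theorems.LerayQuarterDissipationFiniteDissipationLiouvilleSliceLSix
import Literature.Analysis.FluidPDE.AncientL3BackwardLiouvilleHolds
import Literature.Analysis.FluidPDE.CriticalSpaces
import Literature.Analysis.FluidPDE.FourierL2Sobolev
import HarnessLib

/-!
# `FiniteDissipationLiouville`, line `birth`: the leaves reached by Albritton–Barker's backward
# `L³` Liouville theorem (the `L³` corner of the crux and of the DSS wall)

Crux `Summit.NavierStokesRegularity.NavierStokesRegularity.Theses.LerayQuarterDissipation.FiniteDissipationLiouville`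
(item stmt-NavierStokesRegularity-22144), route LerayQuarterDissipation, line `birth`, lead prover
ns-lqd-lead g2. NS regularity is NOT proved by anything here; no summit is.

The tree PROVES Albritton–Barker 2019, Thm 1.2 (`AlbrittonBarker2019_liouville_L3_backward_holds`,
J. Math. Fluid Mech. 21 (2019) no. 43 = arXiv:1811.00502: a bounded ancient mild solution with
`sup_k ‖v(τ_k)‖_{L³} < ∞` along `τ_k → −∞` vanishes; discharged in the tree along Seregin's `L³`
machinery and the Escauriaza–Seregin–Šverák backward uniqueness). This file transports it to the
Type-I ancient mild class of the crux (time shift `t ↦ t − δ` makes the field bounded,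
`IsTypeIAncientMild.comp_sub_right`) and harvests three leaves:

* `eq_zero_of_eLpNorm_three_le_backward` — **the `L³` corner of the crux**: a Type-I ancient mild
  field (no dissipation law needed) whose slices are bounded in `L³(ℝ³)` along SOME sequence of
  times `τ_k → −∞` vanishes on `t < 0`; `notSingular_of_eLpNorm_three_le_backward` is the
  regularity form.
* `eq_zero_of_pastDss_of_eLpNorm_three_lt_top` — **the `L³` leaf of the DSS wall, every `λ > 1`**:
  a Type-I ancient mild field which is `c`-DSS on the past (`c • u (c²t) (c•x) = u t x`, `t < 0`,
  `1 < c`) and has ONE slice in `L³` vanishes: the `L³(ℝ³)` norm is invariant under the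
  Navier–Stokes scaling (`eLpNorm_three_rescaleData`), so it is constant along the backward orbit
  `(c²)^k t₁ → −∞`. (Compare the catalogued wall `TypeIDSSLiouville c`, Bradshaw–Tsai OP 5.1, known
  before only for `c` near `1`, Chae–Wolf 2017: the residue of the wall is the `L³`-TAIL of one
  slice, i.e. a nonzero (`−1`)-homogeneous final blow-down datum.) `…_of_dss_…` is the version for
  the tree's time-global `IsDiscretelySelfSimilar`.
* `eq_zero_of_scaledEnergy_le_backward` — **the scaled-energy leaf of the crux on the stratum**:
  a member of the finite-dissipation stratum (`∫‖∇ū(s)‖² ≤ K/√(−s)`) whose GLOBAL scaled energy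
  `(−s)^{-1/2} ∫ |ū(s)|²` is bounded along some `τ_k → −∞` vanishes — the quarter law puts every
  slice in `L⁶` with `‖ū(s)‖₆ ≤ C_L √(K⁺/√(−s))` (`memLp_six_slice`, p582526) and
  `‖ū‖₃ ≤ ‖ū‖₂^{1/2} ‖ū‖₆^{1/2}` makes the two rates cancel exactly. In particular every
  finite-energy-profile DSS member (`U ∈ L²`, any `λ`) and every member with
  `sup_s (−s)^{-1/2}‖ū(s)‖₂² < ∞` is trivial (`eq_zero_of_pastDss_of_eLpNorm_two_lt_top`).
-/

noncomputable section

open MeasureTheory Set Function Filter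
open scoped Topology ENNReal NNReal

namespace Summit.NavierStokesRegularity.NavierStokesRegularity.Theorems.FiniteDissipationLiouville.Birth

open Literature.Analysis.FluidPDE

-- the problem-side namespace duplicates `NavierStokesRegularity` by design (summit = problem)
set_option linter.dupNamespace false

/-! ### The `L³` corner of the crux (Albritton–Barker 2019 Thm 1.2 in the Type-I class) -/

/-- **The `L³` corner of `FiniteDissipationLiouville` / of KNSS's (L′).** A Type-I ancient mild
field in the KNSS gauge whose slices are bounded in `L³(ℝ³)` along some sequence of times
`τ_k → −∞` vanishes identically on `t < 0`. Proof: for `t < 0` shift time by `δ = −t/2`; the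
shifted field `s ↦ u(s − δ)` is a BOUNDED ancient mild solution in the Oseen integral-equation class
(bound `C/√δ`), `L³`-bounded along `τ_{k+N} + δ → −∞`, so Albritton–Barker 2019 Thm 1.2 (tree:
`AlbrittonBarker2019_liouville_L3_backward_holds`) makes it vanish on `s < 0`, in particular at
`s = t + δ < 0`. No dissipation law is used. -/
theorem eq_zero_of_eLpNorm_three_le_backward {C : ℝ}
    {u : ℝ → EuclideanSpace ℝ (Fin 3) → EuclideanSpace ℝ (Fin 3)} (hu : IsTypeIAncientMild C u)
    {τ : ℕ → ℝ} (hτ : Tendsto τ atTop atBot) {M : ℝ≥0∞} (hM : M < ⊤)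
    (h3 : ∀ k, eLpNorm (u (τ k)) 3 volume ≤ M) : ∀ t < 0, ∀ x, u t x = 0 := by
  intro t ht x
  -- shift time by `δ = -t/2 > 0`
  set δ : ℝ := -t / 2 with hδ
  have hδ0 : 0 < δ := by rw [hδ]; linarith
  set v : ℝ → EuclideanSpace ℝ (Fin 3) → EuclideanSpace ℝ (Fin 3) := fun s => u (s - δ) with hv
  have hvcls : IsTypeIAncientMild C v := hu.comp_sub_right hδ0.le
  -- the shifted field is bounded on the whole open slab
  have hbd : ∃ K : ℝ, ∀ s < 0, ∀ y, ‖v s y‖ ≤ K := by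
    refine ⟨C / Real.sqrt δ, fun s hs y => ?_⟩
    have h1 := hu.norm_le (t := s - δ) (by linarith) y
    refine h1.trans (div_le_div_of_nonneg_left hu.nonneg (Real.sqrt_pos.2 hδ0)
      (Real.sqrt_le_sqrt (by linarith)))
  -- index shift: `τ k < -δ` for `k ≥ N`
  obtain ⟨N, hN⟩ := eventually_atTop.1 (hτ.eventually (eventually_lt_atBot (-δ)))
  have hseq : Tendsto (fun k => τ (k + N) + δ) atTop atBot :=
    tendsto_atBot_add_const_right _ _ (hτ.comp (tendsto_add_atTop_nat N))
  have hneg : ∀ k, τ (k + N) + δ < 0 := fun k => by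
    have := hN (k + N) (Nat.le_add_left N k)
    linarith
  have h3' : ∀ k, eLpNorm (v (τ (k + N) + δ)) 3 volume ≤ M := fun k => by
    simp only [hv, add_sub_cancel_right]
    exact h3 (k + N)
  have key := AlbrittonBarker2019_liouville_L3_backward_holds hvcls.continuousOn_uncurry hbd
    (fun s hs => hvcls.isWeaklyDivFree hs)
    (fun s s' hss' hs' y => hvcls.mild_eq_heatExtension hss' hs' y)
    ⟨fun k => τ (k + N) + δ, M, hM, hseq, hneg, h3'⟩ (t + δ) (by rw [hδ]; linarith) x
  simp only [hv, add_sub_cancel_right] at key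
  exact key

/-- The `L³` corner in the regularity form of the crux: such a field is bounded on some backward
cylinder at the origin (indeed it is `0`). -/
theorem notSingular_of_eLpNorm_three_le_backward {C : ℝ}
    {u : ℝ → EuclideanSpace ℝ (Fin 3) → EuclideanSpace ℝ (Fin 3)} (hu : IsTypeIAncientMild C u)
    {τ : ℕ → ℝ} (hτ : Tendsto τ atTop atBot) {M : ℝ≥0∞} (hM : M < ⊤)
    (h3 : ∀ k, eLpNorm (u (τ k)) 3 volume ≤ M) :
    ¬ (∀ r > 0, ∀ M : ℝ, ∃ t ∈ Set.Ioo (-(r ^ 2)) (0 : ℝ),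
        ∃ x ∈ Metric.ball (0 : EuclideanSpace ℝ (Fin 3)) r, M < ‖u t x‖) := by
  intro hsing
  obtain ⟨t, ht, x, -, hMx⟩ := hsing 1 one_pos 0
  rw [eq_zero_of_eLpNorm_three_le_backward hu hτ hM h3 t ht.2 x, norm_zero] at hMx
  exact lt_irrefl _ hMx

/-! ### The `L³` leaf of the DSS wall, every `λ > 1` -/

/-- **The `L³(ℝ³)` norm is constant along the backward scaling orbit of a past-DSS field**:
if `c • u (c²t) (c•x) = u t x` for all `t < 0` (`0 < c`), then
`‖u((c²)^k t₁)‖_{L³} = ‖u(t₁)‖_{L³}` for every `t₁ < 0` and `k : ℕ` (scale invariance of `L³`,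
tree `eLpNorm_three_rescaleData`). -/
theorem eLpNorm_three_orbit_eq_of_pastDss {c : ℝ} (hc : 0 < c)
    {u : ℝ → EuclideanSpace ℝ (Fin 3) → EuclideanSpace ℝ (Fin 3)}
    (hpast : ∀ t : ℝ, t < 0 → ∀ x, c • u (c ^ 2 * t) (c • x) = u t x) {t₁ : ℝ} (ht₁ : t₁ < 0)
    (k : ℕ) : eLpNorm (u ((c ^ 2) ^ k * t₁)) 3 volume = eLpNorm (u t₁) 3 volume := by
  have hstep : ∀ s : ℝ, s < 0 → eLpNorm (u (c ^ 2 * s)) 3 volume = eLpNorm (u s) 3 volume := by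
    intro s hs
    have e : u s = rescaleData c (u (c ^ 2 * s)) :=
      funext fun x => by rw [rescaleData_apply]; exact (hpast s hs x).symm
    rw [e, eLpNorm_three_rescaleData _ hc]
  induction k with
  | zero => simp
  | succ k ih =>
    have hs : (c ^ 2) ^ k * t₁ < 0 := mul_neg_of_pos_of_neg (by positivity) ht₁
    rw [pow_succ, mul_comm ((c ^ 2) ^ k) (c ^ 2), mul_assoc, hstep _ hs, ih]

/-- **The `L³` leaf of the Type-I DSS wall, every `λ > 1`.** A Type-I ancient mild field in the
KNSS gauge which is discretely self-similar ON THE PAST with factor `c > 1`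
(`c • u (c²t) (c•x) = u t x` for `t < 0`) and has ONE slice `u t₁`, `t₁ < 0`, in `L³(ℝ³)`
vanishes identically on `t < 0`: the `L³` norm is constant along the backward orbit
`(c²)^k t₁ → −∞` (`eLpNorm_three_orbit_eq_of_pastDss`), and the `L³` corner
`eq_zero_of_eLpNorm_three_le_backward` applies. No dissipation law and no envelope is used; the
catalogued wall `Literature.Analysis.FluidPDE.TypeIDSSLiouville c` (Bradshaw–Tsai 2017 OP 5.1) is
thereby reduced, on the gauge class, to the `L³`-tail of a single slice. -/
theorem eq_zero_of_pastDss_of_eLpNorm_three_lt_top {C c : ℝ}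
    {u : ℝ → EuclideanSpace ℝ (Fin 3) → EuclideanSpace ℝ (Fin 3)} (hu : IsTypeIAncientMild C u)
    (hc : 1 < c) (hpast : ∀ t : ℝ, t < 0 → ∀ x, c • u (c ^ 2 * t) (c • x) = u t x)
    {t₁ : ℝ} (ht₁ : t₁ < 0) (h3 : eLpNorm (u t₁) 3 volume < ⊤) : ∀ t < 0, ∀ x, u t x = 0 := by
  have hc0 : 0 < c := one_pos.trans hc
  have hc2 : 1 < c ^ 2 := by nlinarith
  have hτ : Tendsto (fun k : ℕ => (c ^ 2) ^ k * t₁) atTop atBot :=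
    (tendsto_pow_atTop_atTop_of_one_lt hc2).atTop_mul_const_of_neg ht₁
  exact eq_zero_of_eLpNorm_three_le_backward hu hτ h3
    (fun k => (eLpNorm_three_orbit_eq_of_pastDss hc0 hpast ht₁ k).le)

/-- The same leaf for the tree's time-global `IsDiscretelySelfSimilar c u` (`nsRescale c u = u`),
which implies past-DSS. -/
theorem eq_zero_of_dss_of_eLpNorm_three_lt_top {C c : ℝ}
    {u : ℝ → EuclideanSpace ℝ (Fin 3) → EuclideanSpace ℝ (Fin 3)} (hu : IsTypeIAncientMild C u)
    (hc : 1 < c) (hdss : IsDiscretelySelfSimilar c u)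
    {t₁ : ℝ} (ht₁ : t₁ < 0) (h3 : eLpNorm (u t₁) 3 volume < ⊤) : ∀ t < 0, ∀ x, u t x = 0 :=
  eq_zero_of_pastDss_of_eLpNorm_three_lt_top hu hc
    (fun t _ x => by
      have := congrFun (congrFun hdss t) x
      rwa [nsRescale_apply] at this) ht₁ h3

/-- The `L³` leaf of the DSS wall in the regularity form of the crux's DSS stub. -/
theorem notSingular_of_pastDss_of_eLpNorm_three_lt_top {C c : ℝ}
    {u : ℝ → EuclideanSpace ℝ (Fin 3) → EuclideanSpace ℝ (Fin 3)} (hu : IsTypeIAncientMild C u)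
    (hc : 1 < c) (hpast : ∀ t : ℝ, t < 0 → ∀ x, c • u (c ^ 2 * t) (c • x) = u t x)
    {t₁ : ℝ} (ht₁ : t₁ < 0) (h3 : eLpNorm (u t₁) 3 volume < ⊤) :
    ¬ (∀ r > 0, ∀ M : ℝ, ∃ t ∈ Set.Ioo (-(r ^ 2)) (0 : ℝ),
        ∃ x ∈ Metric.ball (0 : EuclideanSpace ℝ (Fin 3)) r, M < ‖u t x‖) := by
  intro hsing
  obtain ⟨t, ht, x, -, hMx⟩ := hsing 1 one_pos 0
  rw [eq_zero_of_pastDss_of_eLpNorm_three_lt_top hu hc hpast ht₁ h3 t ht.2 x, norm_zero] at hMx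
  exact lt_irrefl _ hMx

/-! ### The scaled-energy leaf on the finite-dissipation stratum -/

/-- **Interpolation `‖f‖_{L³} ≤ ‖f‖_{L²}^{1/2} ‖f‖_{L⁶}^{1/2}`** for vector fields on `ℝ³`
(the tree's `FourierNS.eLpNorm_three_le` for scalar functions, applied to `x ↦ ‖f x‖`). -/
theorem eLpNorm_three_le_two_six {f : EuclideanSpace ℝ (Fin 3) → EuclideanSpace ℝ (Fin 3)}
    (hf : AEStronglyMeasurable f volume) :
    eLpNorm f 3 volume ≤ eLpNorm f 2 volume ^ (1 / 2 : ℝ) * eLpNorm f 6 volume ^ (1 / 2 : ℝ) := by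
  have hw : AEStronglyMeasurable (fun x => ((‖f x‖ : ℝ) : ℂ)) volume :=
    Complex.continuous_ofReal.comp_aestronglyMeasurable hf.norm
  have e : ∀ p : ℝ≥0∞, eLpNorm (fun x => ((‖f x‖ : ℝ) : ℂ)) p volume = eLpNorm f p volume :=
    fun p => eLpNorm_congr_norm_ae (Eventually.of_forall fun x => by simp)
  have h := FourierNS.eLpNorm_three_le volume hw
  rwa [e, e, e] at h

/-- **The scaled-energy leaf of `FiniteDissipationLiouville`.** A member of the finite-dissipation
Type-I ancient mild stratum (`∫ ‖∇ū(s)‖² ≤ K/√(−s)` for `s < 0`) whose global scaled energy is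
bounded along some sequence of negative times `τ_k → −∞`,
`∫ |ū(τ_k)|² ≤ E √(−τ_k)`, vanishes identically on `t < 0`. Proof: the quarter law puts every slice
in `L⁶` with `‖ū(s)‖₆ ≤ C_L √(K⁺/√(−s))` (`memLp_six_slice`), so by
`‖ū‖₃ ≤ ‖ū‖₂^{1/2}‖ū‖₆^{1/2}` the `L³` norms along `τ_k` are bounded by `√(C_L √(E⁺K⁺))` — the
two quarter rates cancel — and the `L³` corner applies. (For a `λ`-DSS member the hypothesis
reads `U ∈ L²(ℝ³)` for the profile: finite-energy profiles are excluded for every `λ`.) -/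
theorem eq_zero_of_scaledEnergy_le_backward {C K : ℝ}
    {u : ℝ → EuclideanSpace ℝ (Fin 3) → EuclideanSpace ℝ (Fin 3)} (hu : IsTypeIAncientMild C u)
    (hD : ∀ s : ℝ, s < 0 → ∫⁻ x, ‖fderiv ℝ (u s) x‖ₑ ^ 2 ≤ ENNReal.ofReal (K / Real.sqrt (-s)))
    {τ : ℕ → ℝ} (hτ : Tendsto τ atTop atBot) (hτ0 : ∀ k, τ k < 0) {E : ℝ}
    (hE : ∀ k, ∫⁻ x, ‖u (τ k) x‖ₑ ^ 2 ≤ ENNReal.ofReal (E * Real.sqrt (-τ k))) :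
    ∀ t < 0, ∀ x, u t x = 0 := by
  obtain ⟨CL, hCL, hsix⟩ := memLp_six_slice
  set Kp : ℝ := max K 0 with hKp
  set Ep : ℝ := max E 0 with hEp
  have hKp0 : 0 ≤ Kp := le_max_right _ _
  have hEp0 : 0 ≤ Ep := le_max_right _ _
  set B : ℝ := Real.sqrt (CL * Real.sqrt (Ep * Kp)) with hB
  refine eq_zero_of_eLpNorm_three_le_backward hu hτ (M := ENNReal.ofReal B)
    ENNReal.ofReal_lt_top fun k => ?_
  have ht : τ k < 0 := hτ0 k
  set s : ℝ := Real.sqrt (-τ k) with hs_def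
  have hs : 0 < s := Real.sqrt_pos.2 (neg_pos.2 ht)
  obtain ⟨hmem, h6⟩ := hsix C K u hu hD (τ k) ht
  -- the `L²` bound from the scaled energy
  have h2 : eLpNorm (u (τ k)) 2 volume ≤ ENNReal.ofReal (Real.sqrt (Ep * s)) := by
    rw [eLpNorm_eq_lintegral_rpow_enorm_toReal (by norm_num) (by norm_num)]
    have hI : ∫⁻ x, ‖u (τ k) x‖ₑ ^ (2 : ℝ≥0∞).toReal ≤ ENNReal.ofReal (Ep * s) := by
      rw [ENNReal.toReal_ofNat]
      calc ∫⁻ x, ‖u (τ k) x‖ₑ ^ (2 : ℝ) = ∫⁻ x, ‖u (τ k) x‖ₑ ^ 2 := by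
            simp_rw [ENNReal.rpow_two]
        _ ≤ ENNReal.ofReal (E * s) := hE k
        _ ≤ ENNReal.ofReal (Ep * s) :=
            ENNReal.ofReal_le_ofReal (mul_le_mul_of_nonneg_right (le_max_left _ _) hs.le)
    calc (∫⁻ x, ‖u (τ k) x‖ₑ ^ (2 : ℝ≥0∞).toReal) ^ (1 / (2 : ℝ≥0∞).toReal)
        ≤ (ENNReal.ofReal (Ep * s)) ^ (1 / (2 : ℝ≥0∞).toReal) :=
          ENNReal.rpow_le_rpow hI (by rw [ENNReal.toReal_ofNat]; norm_num)
      _ = ENNReal.ofReal (Real.sqrt (Ep * s)) := by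
          rw [ENNReal.toReal_ofNat, ENNReal.ofReal_rpow_of_nonneg (by positivity) (by norm_num),
            Real.sqrt_eq_rpow]
  -- the `L⁶` bound from the quarter law (gauge kills the Sobolev constant)
  have h6' : eLpNorm (u (τ k)) 6 volume ≤ ENNReal.ofReal (CL * Real.sqrt (Kp / s)) := by
    rw [hmem.eLpNorm_eq_integral_rpow_norm (by norm_num) (by norm_num), ENNReal.toReal_ofNat]
    refine ENNReal.ofReal_le_ofReal ?_
    have e16 : ((6 : ℝ)⁻¹) = (1 / 6 : ℝ) := by norm_num
    rw [e16]
    exact h6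
  -- interpolate: the two quarter rates cancel
  have hmeas : AEStronglyMeasurable (u (τ k)) volume := hu.aestronglyMeasurable_slice ht
  have hreal : Real.sqrt (Ep * s) * (CL * Real.sqrt (Kp / s)) = CL * Real.sqrt (Ep * Kp) := by
    rw [mul_left_comm, ← Real.sqrt_mul (by positivity : 0 ≤ Ep * s)]
    congr 2
    field_simp
  calc eLpNorm (u (τ k)) 3 volume
      ≤ eLpNorm (u (τ k)) 2 volume ^ (1 / 2 : ℝ) * eLpNorm (u (τ k)) 6 volume ^ (1 / 2 : ℝ) :=
        eLpNorm_three_le_two_six hmeas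
    _ ≤ ENNReal.ofReal (Real.sqrt (Ep * s)) ^ (1 / 2 : ℝ) *
          ENNReal.ofReal (CL * Real.sqrt (Kp / s)) ^ (1 / 2 : ℝ) := by
        gcongr
    _ = ENNReal.ofReal B := by
        rw [ENNReal.ofReal_rpow_of_nonneg (Real.sqrt_nonneg _) (by norm_num),
          ENNReal.ofReal_rpow_of_nonneg (by positivity) (by norm_num),
          ← ENNReal.ofReal_mul (by positivity),
          ← Real.mul_rpow (Real.sqrt_nonneg _) (by positivity), hreal, hB,
          Real.sqrt_eq_rpow (CL * Real.sqrt (Ep * Kp))]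

/-- The scaled-energy leaf in the regularity form of the crux. -/
theorem notSingular_of_scaledEnergy_le_backward {C K : ℝ}
    {u : ℝ → EuclideanSpace ℝ (Fin 3) → EuclideanSpace ℝ (Fin 3)} (hu : IsTypeIAncientMild C u)
    (hD : ∀ s : ℝ, s < 0 → ∫⁻ x, ‖fderiv ℝ (u s) x‖ₑ ^ 2 ≤ ENNReal.ofReal (K / Real.sqrt (-s)))
    {τ : ℕ → ℝ} (hτ : Tendsto τ atTop atBot) (hτ0 : ∀ k, τ k < 0) {E : ℝ}
    (hE : ∀ k, ∫⁻ x, ‖u (τ k) x‖ₑ ^ 2 ≤ ENNReal.ofReal (E * Real.sqrt (-τ k))) :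
    ¬ (∀ r > 0, ∀ M : ℝ, ∃ t ∈ Set.Ioo (-(r ^ 2)) (0 : ℝ),
        ∃ x ∈ Metric.ball (0 : EuclideanSpace ℝ (Fin 3)) r, M < ‖u t x‖) := by
  intro hsing
  obtain ⟨t, ht, x, -, hMx⟩ := hsing 1 one_pos 0
  rw [eq_zero_of_scaledEnergy_le_backward hu hD hτ hτ0 hE t ht.2 x, norm_zero] at hMx
  exact lt_irrefl _ hMx

/-- **Finite-energy slices of past-DSS members of the stratum.** A member of the finite-dissipation
stratum which is `c`-DSS on the past (`1 < c`) and has ONE slice of finite energy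
(`u t₁ ∈ L²(ℝ³)`, i.e. the DSS profile has finite energy) vanishes on `t < 0`: that slice is in
`L⁶` by the quarter law, hence in `L³` by interpolation, and the `L³` leaf of the wall applies. -/
theorem eq_zero_of_pastDss_of_eLpNorm_two_lt_top {C K c : ℝ}
    {u : ℝ → EuclideanSpace ℝ (Fin 3) → EuclideanSpace ℝ (Fin 3)} (hu : IsTypeIAncientMild C u)
    (hD : ∀ s : ℝ, s < 0 → ∫⁻ x, ‖fderiv ℝ (u s) x‖ₑ ^ 2 ≤ ENNReal.ofReal (K / Real.sqrt (-s)))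
    (hc : 1 < c) (hpast : ∀ t : ℝ, t < 0 → ∀ x, c • u (c ^ 2 * t) (c • x) = u t x)
    {t₁ : ℝ} (ht₁ : t₁ < 0) (h2 : eLpNorm (u t₁) 2 volume < ⊤) : ∀ t < 0, ∀ x, u t x = 0 := by
  obtain ⟨CL, -, hsix⟩ := memLp_six_slice
  have h6 : eLpNorm (u t₁) 6 volume < ⊤ := (hsix C K u hu hD t₁ ht₁).1.eLpNorm_lt_top
  refine eq_zero_of_pastDss_of_eLpNorm_three_lt_top hu hc hpast ht₁ ?_
  refine lt_of_le_of_lt (eLpNorm_three_le_two_six (hu.aestronglyMeasurable_slice ht₁)) ?_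
  exact ENNReal.mul_lt_top (ENNReal.rpow_lt_top_of_nonneg (by norm_num) h2.ne)
    (ENNReal.rpow_lt_top_of_nonneg (by norm_num) h6.ne)

end Summit.NavierStokesRegularity.NavierStokesRegularity.Theorems.FiniteDissipationLiouville.Birth

end
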